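import Mathlib
import Summits.Ventures.HodgeRepro.Tier4.Line4.ArchWitnessLeftLaw
import Summits.Ventures.HodgeRepro.Tier4.Line4.DichotomyLin
import Summits.Ventures.HodgeRepro.Tier4.Line4.SeesawDistribution
import Summits.Ventures.HodgeRepro.Tier4.Line1.RationalConjScalar
import Summits.Ventures.HodgeRepro.Tier4.Line4.ArchSeesawBridge

/-!
# Tier4/Line4/GammaWitness — C-L4-GAMMA-WITNESS: a rational, linearly regular `γ₀` with non-vanishing branch witness at the
identity instance of the seesaw plane — by construction

Blind re-derivation cell `pub-hodge-repro`, Tier 4 «prove the step» (README §9–§10), seat t4-L4-p1 (prover, LINE L4, gen 5;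
plan-4 g8's second item S16465, statement posted S16496, GO S16497/S16500).  Tree path
`lean/Summits/Ventures/HodgeRepro/Tier4/Line4/GammaWitness.lean`.  Imports x2's ArchWitnessLeftLaw (p718716: `archWitnessOf_ne_zero_iff`,
`defCoeff_ne_zero_iff`), L1-p1's DichotomyLin (through it L1-p3's `isLinRegular_of_no_shared_line`), L4-p2's SeesawDistribution
(`isGenuineRow_seesawPlane`), L1-p2's RationalConjScalar (`mem_rationalPoints_of_mat`), L1-p5's ArchSeesawBridge
(`adToC_algebraMap_eq_embedding`).  Mathlib-level; no literature; no `def`.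

WHAT IS PROVED.  `exists_gamma_witness`: for the plane data `q` (trace-zero, `−n` not a square), scalars `a` (all non-zero), the
identity instance `g = g′ = 1`, `lam = 1`, and the `U(1,1)` signs at `w₀`, there is a RATIONAL point `γ₀` of
`(mixedRow q (a 0) (a 2)).withTransportedTorus 1 1 h11 h11 hΩ1` with `IsLinRegular γ₀` and `archWitnessOf … γ₀ ≠ 0`.
THE WITNESS is explicit: `(c, y)` a rational point of the conic `α c² + β y² = α` (`α := a 0`, `β := −a 2`) with `c y ≠ 0`
(`exists_conic_point`: `c = (β m² − α)/(α + β m²)`, `y = −2 α m/(α + β m²)`, `t = 2 β m/(α + β m²)` for `m ∈ {1, 2}`), and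
`γ₀ = [[c, y], [t, c]]` with `k`-scalar `2 × 2` blocks: `γ₀ Ω = Ω γ₀` (`scalarBlocks_mul_blockDiag4_comm`), `γ₀ B γ₀ᵀ = B`
(`scalarBlocks_mul_blockDiag4_mul_transpose`), `det = c² − y t = 1` (`scalarBlocks_mul_inv`).  Linear regularity: the line
`γ₀ (im P₀) γ₀⁻¹` contains `γ₀ e₀ = (c, 0, t, 0)`, in neither `im P₀` (`t ≠ 0`) nor `im P₁` (`c ≠ 0`).  Non-vanishing: at
every definite place `w′` the `T′`-adapted diagonal entries of `γ₀` are `w′.embedding c ≠ 0` (the `ω`-coordinates of the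
diagonal blocks vanish), so x2's pointwise criterion applies — a RATIONAL, place-independent condition: no weak approximation,
no density of `G(k)`.

What it inhabits: the (7a) residual's `γ₀ hreg hW` at the plane instance of record (the K-type identity `hK` and the
pseudo-coefficient print `hpseudo_cof` stay the display's; display (7b)'s `hγ₀` at this `γ₀` holds at every prime away from the
denominators of `c, y, t`; `haway` stays the display).  Nothing here says anything about the status of the Hodge conjecture for
CM abelian varieties, which is NOT proved (HC_CM is NOT proved by anyone in this repository).
-/

set_option autoImplicit false

noncomputable section

namespace Summit.Ventures.HodgeRepro.Tier4.Line4

open Summit.Ventures.HodgeRepro.Tier4.Common Summit.Ventures.HodgeRepro.Tier4.Line1 NumberField Matrix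

section Scalars

variable {k : Type} [Field k] [CharZero k]

/-- **The conic point**: for `α, β ≠ 0` there are `c, y, t ∈ k`, all non-zero, with `α c² + β y² = α`, `α t + β y = 0`,
`α t² + β c² = β` and `c² − y t = 1` — the scalar identities behind the rational unitary matrix `[[c, y], [t, c]]` of the
hermitian plane `⟨α⟩ ⊕ ⟨β⟩` (`m ∈ {1, 2}`: `c = (β m² − α)/(α + β m²)`, `y = −2 α m/(α + β m²)`, `t = 2 β m/(α + β m²)`;
if `m = 1` is degenerate then `α = ±β` and `m = 2` is not). -/
theorem exists_conic_point {α β : k} (hα : α ≠ 0) (hβ : β ≠ 0) :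
    ∃ c y t : k, α * c ^ 2 + β * y ^ 2 = α ∧ α * t + β * y = 0 ∧ α * t ^ 2 + β * c ^ 2 = β ∧
      c ^ 2 - y * t = 1 ∧ c ≠ 0 ∧ y ≠ 0 ∧ t ≠ 0 := by
  -- a non-degenerate parameter `m`
  obtain ⟨m, hm0, hD, hc⟩ : ∃ m : k, m ≠ 0 ∧ α + β * m ^ 2 ≠ 0 ∧ β * m ^ 2 - α ≠ 0 := by
    by_cases h1 : α + β * 1 ^ 2 ≠ 0 ∧ β * 1 ^ 2 - α ≠ 0
    · exact ⟨1, one_ne_zero, h1.1, h1.2⟩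
    · refine ⟨2, two_ne_zero, ?_, ?_⟩
      · intro h2
        rcases not_and_or.1 h1 with h1 | h1
        · have h1' := not_ne_iff.mp h1
          apply hβ
          linear_combination (1 / 3 : k) * h2 - (1 / 3 : k) * h1'
        · have h1' := not_ne_iff.mp h1
          apply hβ
          linear_combination (1 / 5 : k) * h2 + (1 / 5 : k) * h1'
      · intro h2
        rcases not_and_or.1 h1 with h1 | h1
        · have h1' := not_ne_iff.mp h1
          apply hβ
          linear_combination (1 / 5 : k) * h2 + (1 / 5 : k) * h1'
        · have h1' := not_ne_iff.mp h1
          apply hβ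
          linear_combination (1 / 3 : k) * h2 - (1 / 3 : k) * h1'
  refine ⟨(β * m ^ 2 - α) / (α + β * m ^ 2), -2 * α * m / (α + β * m ^ 2), 2 * β * m / (α + β * m ^ 2),
    ?_, ?_, ?_, ?_, ?_, ?_, ?_⟩
  · field_simp
    ring
  · field_simp
    ring
  · field_simp
    ring
  · field_simp
    ring
  · exact div_ne_zero hc hD
  · exact div_ne_zero (mul_ne_zero (mul_ne_zero (by norm_num) hα) hm0) hD
  · exact div_ne_zero (mul_ne_zero (mul_ne_zero (by norm_num) hβ) hm0) hD

end Scalars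

section Blocks

variable {k : Type} [Field k]

/-- `lineGramRow q a = a • lineGramRow q 1`. -/
theorem lineGramRow_eq_smul_one (q : QuadData k) (a : k) : lineGramRow q a = a • lineGramRow q 1 := by
  simp only [lineGramRow, smul_smul, mul_one]

/-- The transpose of a reindexed block matrix. -/
theorem re4_fromBlocks_transpose (A B C D : Matrix (Fin 2) (Fin 2) k) :
    (re4 (fromBlocks A B C D))ᵀ = re4 (fromBlocks Aᵀ Cᵀ Bᵀ Dᵀ) := by
  simp only [re4, coe_reindexAlgEquiv, transpose_reindex, fromBlocks_transpose]

/-- The `k`-scalar block matrix `[[c, y], [t, c]]` commutes with `Ω = diag(ω, ω)`. -/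
theorem scalarBlocks_mul_blockDiag4_comm (c y t : k) (X : Matrix (Fin 2) (Fin 2) k) :
    re4 (fromBlocks (c • (1 : Matrix (Fin 2) (Fin 2) k)) (y • 1) (t • 1) (c • 1)) * blockDiag4 X X =
      blockDiag4 X X * re4 (fromBlocks (c • (1 : Matrix (Fin 2) (Fin 2) k)) (y • 1) (t • 1) (c • 1)) := by
  simp only [blockDiag4, ← map_mul, fromBlocks_multiply, Matrix.smul_mul, Matrix.mul_smul, Matrix.one_mul,
    Matrix.mul_one, Matrix.mul_zero, smul_zero, add_zero, zero_add]

/-- **The unitary identity of `[[c, y], [t, c]]`** for the diagonal form `diag(α S, β S)` under the conic relations: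
`M B Mᵀ = B`. -/
theorem scalarBlocks_mul_blockDiag4_mul_transpose (S : Matrix (Fin 2) (Fin 2) k) {α β c y t : k}
    (E1 : α * c ^ 2 + β * y ^ 2 = α) (E2 : α * t + β * y = 0) (E3 : α * t ^ 2 + β * c ^ 2 = β) :
    re4 (fromBlocks (c • (1 : Matrix (Fin 2) (Fin 2) k)) (y • 1) (t • 1) (c • 1)) * blockDiag4 (α • S) (β • S) *
      (re4 (fromBlocks (c • (1 : Matrix (Fin 2) (Fin 2) k)) (y • 1) (t • 1) (c • 1)))ᵀ = blockDiag4 (α • S) (β • S) := by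
  rw [re4_fromBlocks_transpose]
  simp only [transpose_smul, transpose_one, blockDiag4, ← map_mul, fromBlocks_multiply, Matrix.smul_mul,
    Matrix.mul_smul, Matrix.one_mul, Matrix.mul_one, Matrix.mul_zero, add_zero, zero_add, smul_smul]
  congr 1
  rw [fromBlocks_inj]
  refine ⟨?_, ?_, ?_, ?_⟩
  · rw [← add_smul]
    congr 1
    linear_combination E1
  · rw [← add_smul]
    rw [show t * (α * c) + c * (β * y) = 0 by linear_combination c * E2, zero_smul]
  · rw [← add_smul]
    rw [show c * (α * t) + y * (β * c) = 0 by linear_combination c * E2, zero_smul]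
  · rw [← add_smul]
    congr 1
    linear_combination E3

/-- The four embeddings `Fin 2 ⊕ Fin 2 → Fin 4` on literals. -/
theorem re4_apply (X : Matrix (Fin 2 ⊕ Fin 2) (Fin 2 ⊕ Fin 2) k) (i j : Fin 4) :
    re4 X i j = X (finSumFinEquiv.symm i) (finSumFinEquiv.symm j) := by
  simp [re4, coe_reindexAlgEquiv, Matrix.reindex_apply, Matrix.submatrix_apply]

/-- The entries of a reindexed block matrix that the witness needs. -/
theorem re4_fromBlocks_entries (A B C D : Matrix (Fin 2) (Fin 2) k) :
    re4 (fromBlocks A B C D) 0 0 = A 0 0 ∧ re4 (fromBlocks A B C D) 1 0 = A 1 0 ∧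
    re4 (fromBlocks A B C D) 2 0 = C 0 0 ∧ re4 (fromBlocks A B C D) 3 0 = C 1 0 ∧
    re4 (fromBlocks A B C D) 2 2 = D 0 0 ∧ re4 (fromBlocks A B C D) 3 2 = D 1 0 := by
  refine ⟨?_, ?_, ?_, ?_, ?_, ?_⟩ <;> rw [re4_apply] <;> rfl

/-- Rows `2`, `3` of `blockDiag4 A 0` vanish. -/
theorem blockDiag4_zero_right_row (A : Matrix (Fin 2) (Fin 2) k) (j : Fin 4) :
    blockDiag4 A 0 2 j = 0 ∧ blockDiag4 A 0 3 j = 0 := by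
  fin_cases j <;> refine ⟨?_, ?_⟩ <;> rw [blockDiag4, re4_apply] <;> rfl

/-- Rows `0`, `1` of `blockDiag4 0 D` vanish. -/
theorem blockDiag4_zero_left_row (D : Matrix (Fin 2) (Fin 2) k) (j : Fin 4) :
    blockDiag4 0 D 0 j = 0 ∧ blockDiag4 0 D 1 j = 0 := by
  fin_cases j <;> refine ⟨?_, ?_⟩ <;> rw [blockDiag4, re4_apply] <;> rfl

/-- Column `0` of the first projector is the first basis vector. -/
theorem blockDiag4_one_zero_col_zero :
    blockDiag4 (1 : Matrix (Fin 2) (Fin 2) k) 0 0 0 = 1 ∧ blockDiag4 (1 : Matrix (Fin 2) (Fin 2) k) 0 1 0 = 0 ∧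
    blockDiag4 (1 : Matrix (Fin 2) (Fin 2) k) 0 2 0 = 0 ∧ blockDiag4 (1 : Matrix (Fin 2) (Fin 2) k) 0 3 0 = 0 := by
  refine ⟨?_, ?_, ?_, ?_⟩ <;> rw [blockDiag4, re4_apply] <;> rfl

/-- `M *ᵥ e₀` is the first column. -/
theorem mulVec_single_zero_one (M : Matrix (Fin 4) (Fin 4) k) :
    M *ᵥ (Pi.single (0 : Fin 4) (1 : k) : Fin 4 → k) = fun i => M i 0 := by
  ext i
  simp [Matrix.mulVec_single]

/-- The inverse of the scalar block matrix `[[c, y], [t, c]]` of determinant `c² − y t = 1`. -/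
theorem scalarBlocks_mul_inv {c y t : k} (hdet : c ^ 2 - y * t = 1) :
    re4 (fromBlocks (c • (1 : Matrix (Fin 2) (Fin 2) k)) (y • 1) (t • 1) (c • 1)) *
      re4 (fromBlocks (c • (1 : Matrix (Fin 2) (Fin 2) k)) ((-y) • 1) ((-t) • 1) (c • 1)) = 1 ∧
    re4 (fromBlocks (c • (1 : Matrix (Fin 2) (Fin 2) k)) ((-y) • 1) ((-t) • 1) (c • 1)) *
      re4 (fromBlocks (c • (1 : Matrix (Fin 2) (Fin 2) k)) (y • 1) (t • 1) (c • 1)) = 1 := by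
  have h1 : fromBlocks (c • (1 : Matrix (Fin 2) (Fin 2) k)) (y • (1 : Matrix (Fin 2) (Fin 2) k))
      (t • (1 : Matrix (Fin 2) (Fin 2) k)) (c • (1 : Matrix (Fin 2) (Fin 2) k)) *
      fromBlocks (c • (1 : Matrix (Fin 2) (Fin 2) k)) ((-y) • (1 : Matrix (Fin 2) (Fin 2) k))
      ((-t) • (1 : Matrix (Fin 2) (Fin 2) k)) (c • (1 : Matrix (Fin 2) (Fin 2) k)) = 1 := by
    rw [fromBlocks_multiply,
      ← (fromBlocks_one : fromBlocks (1 : Matrix (Fin 2) (Fin 2) k) 0 0 (1 : Matrix (Fin 2) (Fin 2) k) = 1),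
      fromBlocks_inj]
    simp only [Matrix.smul_mul, Matrix.mul_smul, Matrix.one_mul, smul_smul, ← add_smul]
    refine ⟨?_, ?_, ?_, ?_⟩
    · convert one_smul k (1 : Matrix (Fin 2) (Fin 2) k) using 2
      linear_combination hdet
    · convert zero_smul k (1 : Matrix (Fin 2) (Fin 2) k) using 2
      ring
    · convert zero_smul k (1 : Matrix (Fin 2) (Fin 2) k) using 2
      ring
    · convert one_smul k (1 : Matrix (Fin 2) (Fin 2) k) using 2
      linear_combination hdet
  have h2 : fromBlocks (c • (1 : Matrix (Fin 2) (Fin 2) k)) ((-y) • (1 : Matrix (Fin 2) (Fin 2) k))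
      ((-t) • (1 : Matrix (Fin 2) (Fin 2) k)) (c • (1 : Matrix (Fin 2) (Fin 2) k)) *
      fromBlocks (c • (1 : Matrix (Fin 2) (Fin 2) k)) (y • (1 : Matrix (Fin 2) (Fin 2) k))
      (t • (1 : Matrix (Fin 2) (Fin 2) k)) (c • (1 : Matrix (Fin 2) (Fin 2) k)) = 1 := by
    rw [fromBlocks_multiply,
      ← (fromBlocks_one : fromBlocks (1 : Matrix (Fin 2) (Fin 2) k) 0 0 (1 : Matrix (Fin 2) (Fin 2) k) = 1),
      fromBlocks_inj]
    simp only [Matrix.smul_mul, Matrix.mul_smul, Matrix.one_mul, smul_smul, ← add_smul]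
    refine ⟨?_, ?_, ?_, ?_⟩
    · convert one_smul k (1 : Matrix (Fin 2) (Fin 2) k) using 2
      linear_combination hdet
    · convert zero_smul k (1 : Matrix (Fin 2) (Fin 2) k) using 2
      ring
    · convert zero_smul k (1 : Matrix (Fin 2) (Fin 2) k) using 2
      ring
    · convert one_smul k (1 : Matrix (Fin 2) (Fin 2) k) using 2
      linear_combination hdet
  exact ⟨by rw [← map_mul, h1, map_one], by rw [← map_mul, h2, map_one]⟩

end Blocks

section Witness

variable {k : Type} [Field k] [NumberField k]

/-- **C-L4-GAMMA-WITNESS (statement S16496, plan-4 g8 S16465 (2)): at the identity instance of the seesaw plane there is a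
RATIONAL point `γ₀` that is linearly regular AND has non-vanishing branch witness `archWitnessOf γ₀ ≠ 0`** — by construction,
with no approximation: `γ₀` is the `E′`-matrix `[[c, y], [t, c]]` with `k`-scalar blocks, `(c, y)` a rational point of the conic
`α c² + β y² = α` (`α = a 0`, `β = −a 2`, `c y ≠ 0`) and `t = −(β/α) y`, so that `γ₀ B γ₀ᵀ = B`, `γ₀ Ω = Ω γ₀`,
`det = c² − y t = 1`.  Linear regularity: the line `γ₀ (im P₀) γ₀⁻¹ = γ₀ (im P₀)` contains `γ₀ e₀ = (c, 0, t, 0)`, which lies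
in neither `im P₀` (`t ≠ 0`) nor `im P₁` (`c ≠ 0`) — L1-p3's `isLinRegular_of_no_shared_line` on L4-p2's
`isGenuineRow_seesawPlane`.  Non-vanishing: by x2's pointwise criterion `archWitnessOf_ne_zero_iff` + `defCoeff_ne_zero_iff`,
at every definite place `w′` the `T′`-adapted diagonal entries are `locEntry′ w′ γ₀ I I = w′.embedding c + w′.embedding 0 · ω_{w′}
= w′.embedding c ≠ 0` — a rational, place-independent condition (the `ω`-coordinates of the diagonal blocks of `γ₀` vanish).
The `U(1,1)` sign binders `ha1`, `ha3` are the criterion's own.  Nothing here chooses the level prime or the K-type data. -/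
theorem exists_gamma_witness (q : QuadData k) (ht : q.t = 0) (hn : ¬ IsSquare (-q.n)) (a : Fin 4 → k)
    (ha : ∀ i, a i ≠ 0)
    (h11 : (1 : Matrix (Fin 4) (Fin 4) k) * 1 = 1)
    (hΩ1 : (1 : Matrix (Fin 4) (Fin 4) k) * (PlaneData.mixedRow q (a 0) (a 2)).Ω =
      (PlaneData.mixedRow q (a 0) (a 2)).Ω * 1)
    (hiso : (1 : Matrix (Fin 4) (Fin 4) k) * (PlaneData.mixedRow q (a 1) (a 3)).B * (1 : Matrix (Fin 4) (Fin 4) k)ᵀ =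
      (1 : k) • (PlaneData.mixedRow q (a 0) (a 2)).B)
    (w₀ : InfinitePlace k) (hw₀ : w₀.IsReal) (hcm : ∀ w, IsCMAt q w)
    (ha1 : 0 < (adToC w₀ (algebraMap k (Ad k) (a 1))).re) (ha3 : (adToC w₀ (algebraMap k (Ad k) (-1 * a 3))).re < 0)
    (eP' eM' : InfinitePlace k → ℤ) :
    ∃ γ₀ : rationalPoints ((PlaneData.mixedRow q (a 0) (a 2)).withTransportedTorus 1 1 h11 h11 hΩ1),
      IsLinRegular ((PlaneData.mixedRow q (a 0) (a 2)).withTransportedTorus 1 1 h11 h11 hΩ1) γ₀ ∧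
      archWitnessOf q a 1 1 h11 h11 hΩ1 1 hiso w₀ eP' eM'
        (γ₀ : GA ((PlaneData.mixedRow q (a 0) (a 2)).withTransportedTorus 1 1 h11 h11 hΩ1)) ≠ 0 := by
  set W := (PlaneData.mixedRow q (a 0) (a 2)).withTransportedTorus 1 1 h11 h11 hΩ1 with hW
  obtain ⟨c, y, t, E1, E2, E3, Edet, hc, _hy, htne⟩ := exists_conic_point (ha 0) (neg_ne_zero.2 (ha 2))
  set M : Matrix (Fin 4) (Fin 4) k :=
    re4 (fromBlocks (c • (1 : Matrix (Fin 2) (Fin 2) k)) (y • 1) (t • 1) (c • 1)) with hM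
  set N : Matrix (Fin 4) (Fin 4) k :=
    re4 (fromBlocks (c • (1 : Matrix (Fin 2) (Fin 2) k)) ((-y) • 1) ((-t) • 1) (c • 1)) with hN
  obtain ⟨hMN, hNM⟩ := scalarBlocks_mul_inv (k := k) Edet
  have hB : W.B = blockDiag4 ((a 0) • lineGramRow q 1) ((-(a 2)) • lineGramRow q 1) := by
    show blockDiag4 (lineGramRow q (a 0)) ((-1 : k) • lineGramRow q (a 2)) = _
    rw [lineGramRow_eq_smul_one q (a 0), lineGramRow_eq_smul_one q (a 2), smul_smul, neg_one_mul]
  have hΩ : W.Ω = blockDiag4 (omegaMat q) (omegaMat q) := rfl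
  have hMΩ : M * W.Ω = W.Ω * M := by
    rw [hΩ]
    exact scalarBlocks_mul_blockDiag4_comm c y t (omegaMat q)
  have hMB : M * W.B * Mᵀ = W.B := by
    rw [hB]
    exact scalarBlocks_mul_blockDiag4_mul_transpose (lineGramRow q 1) E1 E2 E3
  -- the adelic unit and the rational point
  let u : GL4 k := ⟨adMat k M, adMat k N, by rw [← adMat_mul, hMN, adMat_one], by rw [← adMat_mul, hNM, adMat_one]⟩
  have hu : u ∈ unitaryGroup W := by
    refine ⟨?_, ?_⟩
    · show adMat k M * adMat k W.Ω = adMat k W.Ω * adMat k M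
      rw [← adMat_mul, ← adMat_mul, hMΩ]
    · show adMat k M * adMat k W.B * (adMat k M)ᵀ = adMat k W.B
      rw [← adMat_mul, adMat_transpose, ← adMat_mul, hMB]
  let g : GA W := ⟨u, hu⟩
  have hg : GA.mat W g = adMat k M := rfl
  have hgr : g ∈ rationalPoints W := mem_rationalPoints_of_mat W g hg
  -- the entries of `M` that the argument reads
  have hM00 : M 0 0 = c := by
    rw [hM, (re4_fromBlocks_entries _ _ _ _).1]
    simp
  have hM10 : M 1 0 = 0 := by
    rw [hM, (re4_fromBlocks_entries _ _ _ _).2.1]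
    simp
  have hM20 : M 2 0 = t := by
    rw [hM, (re4_fromBlocks_entries _ _ _ _).2.2.1]
    simp
  have hM22 : M 2 2 = c := by
    rw [hM, (re4_fromBlocks_entries _ _ _ _).2.2.2.2.1]
    simp
  have hM32 : M 3 2 = 0 := by
    rw [hM, (re4_fromBlocks_entries _ _ _ _).2.2.2.2.2]
    simp
  have hP0 : W.P 0 = blockDiag4 1 0 := rfl
  have hP1 : W.P 1 = blockDiag4 0 1 := rfl
  have hQ0 : W.Q 0 = 1 * blockDiag4 1 0 * 1 := rfl
  -- `M e₀ = (c, 0, t, 0)` lies in the line `M (im P₀)`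
  have hMe : (M * W.Q 0 * N) *ᵥ (M *ᵥ (Pi.single (0 : Fin 4) (1 : k) : Fin 4 → k)) =
      M *ᵥ (Pi.single (0 : Fin 4) (1 : k) : Fin 4 → k) := by
    rw [Matrix.mulVec_mulVec, Matrix.mul_assoc, hNM, Matrix.mul_one, hQ0, Matrix.one_mul, Matrix.mul_one,
      ← Matrix.mulVec_mulVec, mulVec_single_zero_one (blockDiag4 1 0)]
    congr 1
    obtain ⟨e0, e1, e2, e3⟩ := blockDiag4_one_zero_col_zero (k := k)
    funext i
    fin_cases i
    · show blockDiag4 (1 : Matrix (Fin 2) (Fin 2) k) 0 0 0 = (Pi.single (0 : Fin 4) (1 : k) : Fin 4 → k) 0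
      rw [e0, Pi.single_eq_same]
    · show blockDiag4 (1 : Matrix (Fin 2) (Fin 2) k) 0 1 0 = (Pi.single (0 : Fin 4) (1 : k) : Fin 4 → k) 1
      rw [e1, Pi.single_eq_of_ne (by decide)]
    · show blockDiag4 (1 : Matrix (Fin 2) (Fin 2) k) 0 2 0 = (Pi.single (0 : Fin 4) (1 : k) : Fin 4 → k) 2
      rw [e2, Pi.single_eq_of_ne (by decide)]
    · show blockDiag4 (1 : Matrix (Fin 2) (Fin 2) k) 0 3 0 = (Pi.single (0 : Fin 4) (1 : k) : Fin 4 → k) 3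
      rw [e3, Pi.single_eq_of_ne (by decide)]
  refine ⟨⟨g, hgr⟩, ?_, ?_⟩
  · -- linear regularity from the non-shared line
    have hgen : IsGenuineRow W :=
      isGenuineRow_seesawPlane q ht hn a (ha 0) (ha 2) 1 1 h11 h11 hΩ1 1 one_ne_zero hiso
    refine isLinRegular_of_no_shared_line W hgen ⟨g, hgr⟩ M N hg.symm hMN ?_ ?_
    · intro hrange
      have hmem : M *ᵥ (Pi.single (0 : Fin 4) (1 : k) : Fin 4 → k) ∈ LinearMap.range (W.P 0).mulVecLin := by
        rw [← hrange]
        exact ⟨M *ᵥ Pi.single 0 1, by rw [Matrix.mulVecLin_apply, hMe]⟩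
      obtain ⟨v, hv⟩ := hmem
      rw [mulVec_single_zero_one, Matrix.mulVecLin_apply, hP0] at hv
      have h2 := congrFun hv 2
      simp only [hM20, Matrix.mulVec, dotProduct] at h2
      rw [Finset.sum_eq_zero (fun j _ => by rw [(blockDiag4_zero_right_row (1 : Matrix (Fin 2) (Fin 2) k) j).1, zero_mul])]
        at h2
      exact htne h2.symm
    · intro hrange
      have hmem : M *ᵥ (Pi.single (0 : Fin 4) (1 : k) : Fin 4 → k) ∈ LinearMap.range (W.P 1).mulVecLin := by
        rw [← hrange]
        exact ⟨M *ᵥ Pi.single 0 1, by rw [Matrix.mulVecLin_apply, hMe]⟩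
      obtain ⟨v, hv⟩ := hmem
      rw [mulVec_single_zero_one, Matrix.mulVecLin_apply, hP1] at hv
      have h0 := congrFun hv 0
      simp only [hM00, Matrix.mulVec, dotProduct] at h0
      rw [Finset.sum_eq_zero (fun j _ => by rw [(blockDiag4_zero_left_row (1 : Matrix (Fin 2) (Fin 2) k) j).1, zero_mul])]
        at h0
      exact hc h0.symm
  · -- the branch witness does not vanish: the diagonal `T′`-adapted entries are the embeddings of `c`
    rw [archWitnessOf_ne_zero_iff q a 1 1 h11 h11 hΩ1 1 hiso w₀ eP' eM' hw₀ (hcm w₀) ha1 ha3]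
    intro w' _
    rw [defCoeff_ne_zero_iff]
    have hentry : ∀ i j : Fin 4, entryAt (PlaneData.ofLinesRow q (a 1) (a 3) (-1)) w'
        (conjTo q a 1 1 h11 h11 hΩ1 1 hiso g) i j = w'.embedding (M i j) := by
      intro i j
      rw [entryAt_eq_adToC, mat_conjTo, hg, adMat_one, Matrix.one_mul, Matrix.mul_one]
      exact adToC_algebraMap_eq_embedding w' (M i j)
    have hloc : ∀ I : Fin 2, locEntry' q a 1 1 h11 h11 hΩ1 1 hiso w' g I I ≠ 0 := by
      intro I
      show locEntry q (a 1) (a 3) (-1) w' (conjTo q a 1 1 h11 h11 hΩ1 1 hiso g) I I ≠ 0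
      unfold locEntry
      rw [hentry, hentry]
      fin_cases I
      · show w'.embedding (M 0 0) + w'.embedding (M 1 0) * wroot q w' ≠ 0
        rw [hM00, hM10, map_zero, zero_mul, add_zero]
        exact (map_ne_zero w'.embedding).2 hc
      · show w'.embedding (M 2 2) + w'.embedding (M 3 2) * wroot q w' ≠ 0
        rw [hM22, hM32, map_zero, zero_mul, add_zero]
        exact (map_ne_zero w'.embedding).2 hc
    exact ⟨Or.inr (hloc 0), Or.inr (hloc 1)⟩

end Witness

end Summit.Ventures.HodgeRepro.Tier4.Line4

end
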